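import Literature.Barriers.HodgeConjecture.IntegralCoefficientsProofs
import Literature.AlgebraicTopology.Homotopy.ClassifyingSpace
import HarnessLib

/-!
# Atiyah–Hirzebruch (1962), Prop. 6.6 and 6.7: the deduction of Thm. 6.5 at the classifying space

Second sibling of `Literature/Barriers/HodgeConjecture/IntegralCoefficients.lean` (D-0021 catalogue),
continuing `…IntegralCoefficientsProofs` (which PROVES the last step of Atiyah–Hirzebruch,
*Analytic cycles on complex manifolds*, Topology 1 (1962), Thm. 6.5: an additive integral
operation `θ` on `H⁴(-; ℤ)` that vanishes on supported classes (what Thm. 6.1 says of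
`θ = δ𝒫¹_ℓ`) and detects an `ℓ`-torsion class on a projective algebraic manifold (Thm. 6.5
(i)(ii)) yields the barrier fact `AtiyahHirzebruch1962_torsionClass_notAlgebraic`). Here the two
printed properties of `δ𝒫¹_ℓ` — the reduced power `𝒫¹` abstracted as `∃ P` in the Bockstein
sandwich `β̃ ∘ P ∘ ρ` — are CUT along the printed proof of Thm. 6.5 (p. 41: "This will follow
from (6.1) and the following general results", Prop. 6.6 and Prop. 6.7) into EXPLICIT
HYPOTHESES of proved assembly theorems — Serre's Prop. 6.6 as `hS`, the topological core
Thm. 6.1 ∧ Prop. 6.7 as `hT` (per prime: `VanishesOnSupportedClasses θ`, `DetectsGroupClass ℓ θ`);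
neither is a named fact (both were decomposition children, merged back by the D-0026 review:
the file introduces NO named fact, the barrier fact itself stays the single unproved fact of the
catalogue entry) — and the assembly down to the barrier fact is PROVED:

* Prop. 6.6 (p. 41, due to Serre; proof p. 42): "Let `G` be any finite group and `n` any positive
  integer. Then there exists a projective algebraic manifold `X` having the same `n`-type as the
  product of Eilenberg–MacLane spaces `K(ℤ, 2) × K(G, 1)`. In particular `H*(G; ℤ)` (up to
  dimension `n`) is a direct factor of `H*(X; ℤ)`." The proof takes `X = Y/G` for Serre's complete
  intersection `Y ⊂ P_N` of dimension `r` with a free `G`-action (Serre 1958, §20) and shows that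
  `(f, g) : X → K(ℤ, 2) × B_G` is an `(r - 1)`-homotopy equivalence, `g : X → B_G` "a map inducing
  the covering `Y → X`"; so `g* : Hⁱ(B_G; ℤ) → Hⁱ(X; ℤ)` is (split) injective for `i ≤ n`. It enters
  as the explicit hypothesis `hS` of the three assembly theorems — the printed "in particular"
  clause, through the classifying map `g` of the proof, with INJECTIVITY of `g*` (what "direct
  factor" gives and what the assembly uses): for every finite group `G` and every `N`, a smooth
  projective complex `X` and a continuous `g : X(ℂ) → BG` with `g*` injective on `Hⁱ(-; ℤ)` for
  `i ≤ N`; the `n`-type clause itself is not stated (no `K(ℤ, 2)`, no `n`-types in the tree). It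
  is NOT a named fact: it was the decomposition child `AtiyahHirzebruch1962_serreVariety` of this
  file, merged back into the proof obligation of the barrier fact by the D-0026 review (its
  discharge is theory-sized, see "What remains" below; decomposition children are proved inline
  or merged back, they do not recurse).
* Thm. 6.1 (p. 40) ∧ Prop. 6.7 (p. 41: "Let `p` be any prime, then there exists a finite group `G`
  and a cohomology class `y ∈ H²q(G; ℤ)` of order `p` with `δ𝒫¹(y) ≠ 0`"; proof p. 42:
  `G = ℤ_p × ℤ_p × ℤ_p`, `y = β(u₁u₂u₃)`, so `2q = 4`, Remark (1)), with `𝒫¹` abstracted as an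
  arbitrary additive mod-`ℓ` operation `P` of degree `2ℓ - 2` in the sandwich
  `bocksteinSandwich hℓ P = β̃ ∘ P ∘ ρ` of `…IntegralCoefficientsProofs`: the explicit hypothesis
  `hT` of the assembly theorems (`∀ ℓ` prime `∃ P`, the Bockstein sandwich `β̃ ∘ P ∘ ρ` vanishes
  on supported classes of smooth projective varieties AND detects an `ℓ`-torsion class in
  `H⁴(BG; ℤ)` for some finite group `G`; prime by prime the two predicates
  `VanishesOnSupportedClasses θ`, `DetectsGroupClass ℓ θ`). This is the purely topological core:
  no variety is involved on the detection side any more. It is NOT a named fact: it was the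
  decomposition child `AtiyahHirzebruch1962_classifyingSpaceObstruction` of this file, merged
  back into the proof obligation of the barrier fact by the D-0026 review (see the section
  docstring below for why it cannot be cut out, and "What remains" for its size).
* Assembly (PROVED from the hypotheses `hT` and `hS`,
  `AtiyahHirzebruch1962_obstruction_of_classifyingSpace`): pull the detected class back along `g`;
  `ℓ • g*y = g*(ℓ • y) = 0`, and `θ (g* y) = g* (θ y) ≠ 0` by NATURALITY of the operation
  `θ = β̃Pρ` (`AddCohomologyOperation.naturality`) and injectivity of `g*` in degree `2ℓ + 3` —
  verbatim the printed deduction of Thm. 6.5 (i)(ii) from 6.6 and 6.7; then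
  (`AtiyahHirzebruch1962_torsionClass_notAlgebraic_of_classifyingSpace`) the barrier fact, by the
  vanishing on `N² H⁴` (`VanishesOnSupportedClasses.not_mem_integralAlgebraicClasses`); prime by
  prime, for ANY additive integral `θ` (in print `θ = δ𝒫¹_ℓ ρ_ℓ`), this is
  `DetectsGroupClass.exists_torsionClass_notAlgebraic` — the conjunct of the barrier fact at `ℓ`.

* Reduction of Prop. 6.7 to a computation modulo `ℓ` (PROVED, `DetectsGroupClass.of_integralBockstein`,
  `DetectsGroupClass.of_modBockstein`): the printed witness has the shape `y = β̃ x` for a class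
  `x ∈ H³(BG; ℤ/ℓ)` (p. 42: `x = u₁u₂u₃`, "`y = β(u₁u₂u₃)`"); such a `y` is AUTOMATICALLY of
  order dividing `ℓ` (`ℓ • β̃ x = 0`, the segment `β̃ ≫ ℓ = 0` of the Bockstein sequence — the
  printed appeal to "this group has exponent `p`" is not needed for Bockstein images), and
  `θ y ≠ 0` for `θ = β̃Pρ` follows from the non-vanishing MOD `ℓ` of `β P β x`, `β = ρβ̃` the
  mod-`ℓ` Bockstein (p. 42: "to prove (6.7) we have only to find `y ∈ H²q(G; ℤ_p)` such that
  `β(y) = 0`, `Γ(y) ≠ 0`", `Γ = β𝒫¹ - 𝒫¹β`, `Γ(y) = β𝒫¹(y)` on `Ker β`). What is left of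
  Prop. 6.7 below this lemma is the pure mod-`ℓ` computation in `H*((ℤ_ℓ)³; ℤ_ℓ)`.

Here `BG = Literature.AlgebraicTopology.Homotopy.classifyingSpace G = |N(SingleObj G)|` (Segal's
classifying space of `G` as a one-object category; `H*(BG; ℤ)` is Atiyah–Hirzebruch's `H*(G; ℤ)`,
§1 p. 27 "`B_G` is the classifying space of a group `G`").

What remains (recorded, not attempted; each is a theory absent from Mathlib and the tree): for
the hypothesis `hS` (Prop. 6.6) — Serre's construction as a `k`-scheme satisfying
`IsSmoothProjective` (free actions of a finite group on smooth complete intersections `Y ⊂ P_N`,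
smoothness and projectivity of the quotient `Y/G`), the Lefschetz hyperplane theorem in Bott's
form for `Y(ℂ)`, the comparison of `ComplexPoints (Y/G)` with the quotient manifold `Y(ℂ)/G`, and
the classification of the covering `Y(ℂ) → X(ℂ)` by a continuous map into `BG = |N(SingleObj G)|`
(a `K(G, 1)`); for the hypothesis `hT` (Thm. 6.1 ∧ Prop. 6.7) — a NAMED `P`: the Steenrod
reduced powers `𝒫¹_ℓ` for odd `ℓ` on the tree's singular cohomology (absent), resp. `Sq²` for
`ℓ = 2` (the tree's `Literature.AlgebraicTopology.SingularHomology.steenrodSq` of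
`…SingularHomology.SteenrodSquares` lives on `singularCohomology R R` for rings `R` of
characteristic two, so far without Cartan formula and `Sq¹ = β`), Thm. 6.1 for it (`K`-theory with
supports, `d_{2p-1} = -δ𝒫¹`, Prop. 7.2), and Prop. 6.7 for it
(`H*((ℤ/p)³; ℤ_p) = Λ(u₁,u₂,u₃) ⊗ ℤ_p[v₁,v₂,v₃]`, Cartan formula, `H*(BG) = H*(G)`; reduced below to
the mod-`ℓ` computation by `DetectsGroupClass.of_modBockstein`).

## References

* [AtiyahHirzebruchTopology1962] M. F. Atiyah, F. Hirzebruch, *Analytic cycles on complex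
  manifolds*, Topology 1 (1962) 25–45: Thm. 6.1 (p. 40), Thm. 6.5, Prop. 6.6, Prop. 6.7 (p. 41),
  proofs and Remark (1) (p. 42); their ref. [19] is J-P. Serre, *Sur la topologie des variétés
  algébriques en caractéristique p* (1958), §20 (the varieties `Y/G`).
* [Segal1968] G. Segal, *Classifying spaces and spectral sequences*, Publ. Math. IHÉS 34 (1968),
  §2–§3 (`B𝒞 = |N𝒞|`, `BG`).
* [HatcherAT2002] A. Hatcher, *Algebraic Topology*, §4.L p. 488 (naturality of cohomology
  operations), Example 1B.7 and §2.3 p. 165 (`BG`).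
-/

noncomputable section

open CategoryTheory AlgebraicGeometry
open Literature.AlgebraicTopology.SingularHomology (AddCohomologyOperation singularCohomology)
open Literature.AlgebraicTopology.Homotopy (classifyingSpace)
open Literature.AlgebraicGeometry.Motives (SchemeOver IsSmoothProjective bettiCohomologyInt
  ComplexPoints)

namespace Literature.Barriers.HodgeConjecture

section Barriers
section HodgeConjecture

variable {k : ℕ}

/-! ### Prop. 6.7 as a predicate on an integral operation of source degree 4 -/

/-- What Atiyah–Hirzebruch's Prop. 6.7 asserts of `θ = δ𝒫¹_ℓ ρ_ℓ`, as a predicate on an additive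
integral operation `θ : H⁴(-; ℤ) → Hᵏ(-; ℤ)`: there are a finite group `G` and a class
`y ∈ H⁴(BG; ℤ)` with `ℓ • y = 0` and `θ_{BG} y ≠ 0` ("there exists a finite group `G` and a
cohomology class `y ∈ H²q(G; ℤ)` of order `p` with `δ𝒫¹(y) ≠ 0`"; in the proof `G = (ℤ_p)³`,
`y = β(u₁u₂u₃)`, `2q = 4`; `y ≠ 0` follows from `θ y ≠ 0`). `BG` is the nerve model
`classifyingSpace G`. [cite: AtiyahHirzebruchTopology1962, Prop. 6.7 p. 41 and its proof p. 42] -/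
def DetectsGroupClass (ℓ : ℕ) (θ : AddCohomologyOperation.{0} ℤ ℤ ℤ (2 * 2) k) : Prop :=
  ∃ (G : Type) (_ : Group G) (_ : Finite G)
    (y : singularCohomology ℤ ℤ (classifyingSpace G) (2 * 2)),
    (ℓ : ℤ) • y = 0 ∧ θ.app (classifyingSpace G) y ≠ 0

/-- The zero operation detects nothing: a detecting operation is nonzero at `BG` (so any `P` in
the slot of `𝒫¹` whose sandwich `β̃Pρ` satisfies Prop. 6.7 is a nonzero operation, as `𝒫¹` is).
[cite: AtiyahHirzebruchTopology1962, Prop. 6.7 p. 41] -/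
theorem DetectsGroupClass.ne_zero {ℓ : ℕ} {θ : AddCohomologyOperation.{0} ℤ ℤ ℤ (2 * 2) k}
    (h : DetectsGroupClass ℓ θ) : θ ≠ 0 := by
  rintro rfl
  obtain ⟨G, _, _, y, -, hθ⟩ := h
  exact hθ (AddCohomologyOperation.zero_app y)

/-! ### Prop. 6.6 (Serre's projective algebraic manifolds): an explicit hypothesis, not a fact

**Atiyah–Hirzebruch (1962), Prop. 6.6, cohomological clause.** "Let `G` be any finite group and
`n` any positive integer. Then there exists a projective algebraic manifold `X` having the same
`n`-type as the product of Eilenberg–MacLane spaces `K(ℤ, 2) × K(G, 1)`. In particular `H*(G; ℤ)`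
(up to dimension `n`) is a direct factor of `H*(X; ℤ)`." (p. 41; "Proposition (6.6) and its proof
… are due to J-P. Serre"; proof p. 42: `X = Y/G` for Serre's complete intersection `Y ⊂ P_N` of
dimension `r` with a free `G`-action, `g : X → B_G` "a map inducing the covering `Y → X`",
`(f, g) : X → K(ℤ, 2) × B_G` an `(r-1)`-homotopy equivalence, "taking `r - 1 ≥ n`, and recalling
that `B_G` is a `K(G, 1)`".) The three assembly theorems below take its "in particular" clause,
through the map `g` of the proof, as the explicit hypothesis

  `hS : ∀ (G : Type) [Group G] [Finite G] (N : ℕ), ∃ (n : ℕ) (X : SchemeOver ℂ)`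
  `  (_ : IsSmoothProjective n X) (g : C(ComplexPoints X, classifyingSpace G)),`
  `  ∀ i ≤ N, Function.Injective (singularCohomology.map ℤ ℤ g i)`

— for every finite group `G` and every `N`, a smooth projective complex variety `X` (of some
dimension) and a continuous `g : X(ℂ) → BG` with `g* : Hⁱ(BG; ℤ) → Hⁱ(X(ℂ); ℤ)` injective for all
`i ≤ N` (a direct factor is in particular a subgroup; injectivity is the part used in the proof of
Thm. 6.5). WEAKER than the printed `n`-type statement, which the tree cannot phrase (no `K(ℤ, 2)`,
no `n`-types). This clause was the decomposition child `AtiyahHirzebruch1962_serreVariety` of the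
barrier fact until the D-0026 review merged it back into the barrier's proof obligation: its
discharge is not a lemma but a theory — Serre's `Y/G` as a `k`-scheme with `IsSmoothProjective`,
the Lefschetz hyperplane theorem in Bott's form, `ComplexPoints (Y/G)` versus the quotient
manifold, and the classification of the covering `Y(ℂ) → X(ℂ)` by a map into `|N(SingleObj G)|` —
none of it in Mathlib or the tree (decomposition children are proved inline or merged back; they
do not recurse). [cite: AtiyahHirzebruchTopology1962, Prop. 6.6 p. 41 and its proof p. 42] -/

/-! ### Thm. 6.1 ∧ Prop. 6.7 at the classifying space: an explicit hypothesis, not a fact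

**Atiyah–Hirzebruch (1962), Thm. 6.1 with Prop. 6.7, the operation `𝒫¹` abstracted.** For every
prime `ℓ` there is an additive cohomology operation `P : H⁴(-; ℤ/ℓ) → H^{2ℓ+2}(-; ℤ/ℓ)` — in print
`P = 𝒫¹_ℓ` (`Sq²` for `ℓ = 2`), which the tree cannot yet name for odd `ℓ` — such that the
composite `θ = β̃_ℓ ∘ P ∘ ρ_ℓ : H⁴(-; ℤ) → H^{2ℓ+3}(-; ℤ)` (`bocksteinSandwich`; in print `δ𝒫¹_ℓ`)
(a) annihilates, on every projective algebraic manifold, every integral class supported on a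
Zariski-closed subset of codimension `≥ 2` (Thm. 6.1 p. 40 with §5 and `ℋ* = H*` for compact `X`:
`VanishesOnSupportedClasses`), and (b) is nonzero on some class `y ∈ H⁴(BG; ℤ)` with `ℓ • y = 0`,
for some finite group `G` (Prop. 6.7 pp. 41–42: `G = (ℤ_ℓ)³`, `y = β(u₁u₂u₃)`:
`DetectsGroupClass`). The two assembly theorems below take this, for all primes at once, as the
explicit hypothesis

  `hT : ∀ ⦃ℓ : ℕ⦄ (hℓ : ℓ.Prime), ∃ P : AddCohomologyOperation ℤ (ZMod ℓ) (ZMod ℓ) 4 (2 * ℓ + 2),`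
  `  VanishesOnSupportedClasses (bocksteinSandwich hℓ P) ∧ DetectsGroupClass ℓ (… hℓ P)`

(existentially quantifying `P` is WEAKER than the printed conjunction, never stronger), and
`DetectsGroupClass.exists_torsionClass_notAlgebraic` takes it one prime and one operation at a
time (`hV`, `hD`). This conjunction was the decomposition child
`AtiyahHirzebruch1962_classifyingSpaceObstruction` of the barrier fact until the D-0026 review
merged it back into the barrier's proof obligation: it is not a distinct printed result but
Thm. 6.1 ∧ Prop. 6.7 glued by the shared `∃ P` (inseparable without naming `𝒫¹`), i.e. the
barrier's whole mechanism with the detection conjunct pulled back to `BG`, and its discharge is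
not a lemma but three theories — the reduced powers `𝒫¹_ℓ`, Thm. 6.1 (`K`-theory with supports,
the spectral sequence `H* ⇒ K*`, Prop. 7.2 `d_{2p-1} = -δ𝒫¹`), and Prop. 6.7 (`H*((ℤ_p)³; ℤ_p)`,
Künneth, Cartan formula, `H*(BG) = H*(G)` for the nerve model) — none of it in Mathlib or the
tree (decomposition children are proved inline or merged back; they do not recurse).
[cite: AtiyahHirzebruchTopology1962, Thm. 6.1 p. 40 and Prop. 6.7 pp. 41–42] -/

/-! ### Proved: the deduction of Thm. 6.5 from Prop. 6.6 and Prop. 6.7 -/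

/-- **Thm. 6.5 (i)(ii) from Prop. 6.6 and Prop. 6.7 (proved; Prop. 6.6 an explicit hypothesis).**
If an additive integral operation `θ : H⁴(-; ℤ) → Hᵏ(-; ℤ)` detects an `ℓ`-torsion class
`y ∈ H⁴(BG; ℤ)` of a finite group `G`, and Serre's projective algebraic manifolds exist in the form
of Prop. 6.6 (hypothesis `hS`: for every finite group `G` and every `N` a smooth projective `X` and
a continuous `g : X(ℂ) → BG` with `g*` injective on `Hⁱ(-; ℤ)` for `i ≤ N` — "`H*(G; ℤ)` (up to
dimension `n`) is a direct factor of `H*(X; ℤ)`", `g` "a map inducing the covering `Y → X`"), then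
`θ` detects an `ℓ`-torsion class in `H⁴(X(ℂ); ℤ)` of a smooth projective `X`: take `g : X(ℂ) → BG`
with `g*` injective up to degree `k` and `y' = g* y`; then `ℓ • y' = g*(ℓ • y) = 0` and
`θ y' = g*(θ y) ≠ 0` by naturality of `θ`. This is the printed deduction "This will follow from
(6.1) and the following general results [(6.6), (6.7)]".
[cite: AtiyahHirzebruchTopology1962, proof of Thm. 6.5 p. 41 with Prop. 6.6 pp. 41–42] -/
theorem DetectsGroupClass.detectsTorsionClass
    (hS : ∀ (G : Type) [Group G] [Finite G] (N : ℕ),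
      ∃ (n : ℕ) (X : SchemeOver ℂ) (_ : IsSmoothProjective n X)
        (g : C(ComplexPoints X, classifyingSpace G)),
        ∀ i ≤ N, Function.Injective (singularCohomology.map ℤ ℤ g i))
    {ℓ : ℕ} {θ : AddCohomologyOperation.{0} ℤ ℤ ℤ (2 * 2) k} (h : DetectsGroupClass ℓ θ) :
    DetectsTorsionClass ℓ θ := by
  obtain ⟨G, _, _, y, hy, hθ⟩ := h
  obtain ⟨n, X, hX, g, hg⟩ := hS G k
  refine ⟨n, X, hX, singularCohomology.map ℤ ℤ g (2 * 2) y, ?_, fun h0 ↦ hθ (hg k le_rfl ?_)⟩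
  · have h := congrArg (singularCohomology.map ℤ ℤ g (2 * 2)) hy
    rwa [map_zsmul, _root_.map_zero] at h
  · rw [← θ.naturality g y, _root_.map_zero]
    exact h0

/-- **Assembly, first step (proved): Thm. 6.1 ∧ Thm. 6.5 (i)(ii) for the same operation.**
Thm. 6.1 ∧ Prop. 6.7 (`𝒫¹` abstracted, the explicit hypothesis `hT`) together with Prop. 6.6 (the
explicit hypothesis `hS`, Serre's projective algebraic manifolds) give, for every prime `ℓ`, an
operation
`P` whose Bockstein sandwich `β̃ ∘ P ∘ ρ` vanishes on supported classes AND detects an `ℓ`-torsion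
class in `H⁴(X(ℂ); ℤ)` of a projective algebraic manifold `X` (Thm. 6.5 (i) "`δ𝒫¹_p(y) ≠ 0`",
(ii) "`y` is of order `p`"). [cite: AtiyahHirzebruchTopology1962, Thm. 6.5 p. 41] -/
theorem AtiyahHirzebruch1962_obstruction_of_classifyingSpace
    (hT : ∀ ⦃ℓ : ℕ⦄ (hℓ : ℓ.Prime),
      ∃ P : AddCohomologyOperation.{0} ℤ (ZMod ℓ) (ZMod ℓ) (2 * 2) (2 * ℓ + 2),
        VanishesOnSupportedClasses (bocksteinSandwich hℓ P) ∧
          DetectsGroupClass ℓ (bocksteinSandwich hℓ P))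
    (hS : ∀ (G : Type) [Group G] [Finite G] (N : ℕ),
      ∃ (n : ℕ) (X : SchemeOver ℂ) (_ : IsSmoothProjective n X)
        (g : C(ComplexPoints X, classifyingSpace G)),
        ∀ i ≤ N, Function.Injective (singularCohomology.map ℤ ℤ g i)) :
    ∀ ⦃ℓ : ℕ⦄ (hℓ : ℓ.Prime),
      ∃ P : AddCohomologyOperation.{0} ℤ (ZMod ℓ) (ZMod ℓ) (2 * 2) (2 * ℓ + 2),
        VanishesOnSupportedClasses (bocksteinSandwich hℓ P) ∧
          DetectsTorsionClass ℓ (bocksteinSandwich hℓ P) := by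
  intro ℓ hℓ
  obtain ⟨P, hV, hD⟩ := hT hℓ
  exact ⟨P, hV, hD.detectsTorsionClass hS⟩

/-- **Assembly (proved): Thm. 6.1 ∧ Prop. 6.7 (hypothesis `hT`) and Prop. 6.6 (hypothesis `hS`)
imply the catalogued barrier fact** `AtiyahHirzebruch1962_torsionClass_notAlgebraic` (Thm. 6.5:
"This class is not complex analytic"; Remark (3): "Hodge's conjecture is not true for cohomology
classes of higher dimension"): the detected class `y ∈ H⁴(X(ℂ); ℤ)` has `ℓ • y = 0`, is nonzero
because `θ = β̃Pρ` is additive with `θ y ≠ 0`, and lies outside `N² H⁴ = integralAlgebraicClasses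
X 2` because `θ` vanishes there (`VanishesOnSupportedClasses.not_mem_integralAlgebraicClasses`).
The discharge of the barrier fact is thereby reduced to proofs of the hypotheses `hT` (Thm. 6.1 ∧
Prop. 6.7 for a named `P`, in print `𝒫¹_ℓ`) and `hS` (Prop. 6.6, Serre's varieties).
[cite: AtiyahHirzebruchTopology1962, Thm. 6.5 p. 41 and Remark (3) p. 43] -/
theorem AtiyahHirzebruch1962_torsionClass_notAlgebraic_of_classifyingSpace
    (hT : ∀ ⦃ℓ : ℕ⦄ (hℓ : ℓ.Prime),
      ∃ P : AddCohomologyOperation.{0} ℤ (ZMod ℓ) (ZMod ℓ) (2 * 2) (2 * ℓ + 2),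
        VanishesOnSupportedClasses (bocksteinSandwich hℓ P) ∧
          DetectsGroupClass ℓ (bocksteinSandwich hℓ P))
    (hS : ∀ (G : Type) [Group G] [Finite G] (N : ℕ),
      ∃ (n : ℕ) (X : SchemeOver ℂ) (_ : IsSmoothProjective n X)
        (g : C(ComplexPoints X, classifyingSpace G)),
        ∀ i ≤ N, Function.Injective (singularCohomology.map ℤ ℤ g i)) :
    AtiyahHirzebruch1962_torsionClass_notAlgebraic := by
  intro ℓ hℓ
  obtain ⟨P, hV, n, X, hX, y, hy, hθ⟩ := AtiyahHirzebruch1962_obstruction_of_classifyingSpace hT hS hℓ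
  refine ⟨n, X, hX, y, ?_, hy, hV.not_mem_integralAlgebraicClasses hX hθ⟩
  rintro rfl
  exact hθ (AddCohomologyOperation.map_zero _)

/-- **Thm. 6.5 at one prime, for one operation (proved): the conjunct of the barrier fact at `ℓ`.**
If an additive integral operation `θ : H⁴(-; ℤ) → Hᵏ(-; ℤ)` vanishes on supported classes of smooth
projective varieties (what Thm. 6.1 says of `δ𝒫¹_ℓ ρ_ℓ`, hypothesis `hV`) and detects an
`ℓ`-torsion class of some `H⁴(BG; ℤ)` (Prop. 6.7, hypothesis `hD`), then — granted Serre's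
varieties (Prop. 6.6, hypothesis `hS`) — there are a smooth projective `X` and a nonzero
`y ∈ H⁴(X(ℂ); ℤ)` with `ℓ • y = 0` outside `integralAlgebraicClasses X 2 = N² H⁴(X(ℂ); ℤ)` ("This
class is not complex analytic"): `DetectsGroupClass.detectsTorsionClass` followed by
`exists_torsionClass_notAlgebraic_of_detects` — the form in which a construction of `𝒫¹_ℓ` (of
`Sq²` alone, for `ℓ = 2`) with Thm. 6.1 and Prop. 6.7 for it settles the barrier at that prime.
[cite: AtiyahHirzebruchTopology1962, Thm. 6.5 p. 41 and Remark (3) p. 43] -/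
theorem DetectsGroupClass.exists_torsionClass_notAlgebraic
    (hS : ∀ (G : Type) [Group G] [Finite G] (N : ℕ),
      ∃ (n : ℕ) (X : SchemeOver ℂ) (_ : IsSmoothProjective n X)
        (g : C(ComplexPoints X, classifyingSpace G)),
        ∀ i ≤ N, Function.Injective (singularCohomology.map ℤ ℤ g i))
    {ℓ : ℕ} {θ : AddCohomologyOperation.{0} ℤ ℤ ℤ (2 * 2) k} (hV : VanishesOnSupportedClasses θ)
    (hD : DetectsGroupClass ℓ θ) :
    ∃ (n : ℕ) (X : SchemeOver ℂ) (_ : IsSmoothProjective n X) (y : bettiCohomologyInt X (2 * 2)),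
      y ≠ 0 ∧ (ℓ : ℤ) • y = 0 ∧ y ∉ integralAlgebraicClasses X 2 :=
  exists_torsionClass_notAlgebraic_of_detects hV (hD.detectsTorsionClass hS)

/-! ### Proved: Prop. 6.7 reduced to a computation modulo `ℓ` -/

/-- Multiplication by `m` on the coefficient group `ℤ` induces multiplication by `m` on
`Hⁿ(E; ℤ)`: `(m·)_* y = m • y` (the map "`m`" of the Bockstein sequence of
`0 → ℤ →ᵐ ℤ → ℤₘ → 0`; Hatcher, §3.E p. 303). [cite: HatcherAT2002, §3.E p. 303] -/
theorem singularCohomology_mapCoeff_lsmul_apply {E : Type} [TopologicalSpace E] (m n : ℕ)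
    (y : singularCohomology ℤ ℤ E n) :
    singularCohomology.mapCoeff E (LinearMap.lsmul ℤ ℤ m) n y = (m : ℤ) • y := by
  have h₁ : Literature.AlgebraicTopology.SingularHomology.singularCochainComplex.mapCoeff E
      (LinearMap.lsmul ℤ ℤ m : ℤ →ₗ[ℤ] ℤ) =
      (m : ℤ) • 𝟙 (Literature.AlgebraicTopology.SingularHomology.singularCochainComplex ℤ ℤ E) := by
    ext k φ σ
    simp only [Literature.AlgebraicTopology.SingularHomology.singularCochainComplex.mapCoeff_apply,
      LinearMap.lsmul_apply, smul_eq_mul, HomologicalComplex.zsmul_f_apply,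
      HomologicalComplex.id_f, ModuleCat.hom_zsmul, ModuleCat.hom_id]
    rfl
  have h₂ : singularCohomology.mapCoeff E (LinearMap.lsmul ℤ ℤ m) n =
      (m : ℤ) • 𝟙 (singularCohomology ℤ ℤ E n) := by
    change (HomologicalComplex.homologyFunctor _ _ n).map
      (Literature.AlgebraicTopology.SingularHomology.singularCochainComplex.mapCoeff E
        (LinearMap.lsmul ℤ ℤ m : ℤ →ₗ[ℤ] ℤ)) = _
    rw [h₁, Functor.map_zsmul, CategoryTheory.Functor.map_id]
    rfl
  rw [h₂]
  rfl

/-- **Every integral Bockstein image is `ℓ`-torsion**: `ℓ • β̃ x = 0` for `x ∈ Hⁿ(E; ℤ/ℓ)` (the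
segment `Hⁿ(E; ℤ_ℓ) →β̃ Hⁿ⁺¹(E; ℤ) →ℓ Hⁿ⁺¹(E; ℤ)` of the Bockstein sequence composes to zero;
Hatcher, §3.E p. 303). This is why Atiyah–Hirzebruch's `y = β(u₁u₂u₃) ∈ H⁴(G; ℤ)` is "of order
`p`" (Thm. 6.5 (ii), proof of Prop. 6.7 p. 42) — for a Bockstein image no appeal to the exponent
of `G` is needed. [cite: HatcherAT2002, §3.E p. 303] -/
theorem integralBockstein_zsmul_eq_zero {E : Type} [TopologicalSpace E] (ℓ : ℕ) [NeZero ℓ]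
    (n : ℕ) (x : singularCohomology ℤ (ZMod ℓ) E n) :
    (ℓ : ℤ) • Literature.AlgebraicTopology.SingularHomology.integralBockstein E ℓ n x = 0 := by
  rw [← singularCohomology_mapCoeff_lsmul_apply]
  change (Literature.AlgebraicTopology.SingularHomology.integralBockstein E ℓ n ≫
    singularCohomology.mapCoeff E (LinearMap.lsmul ℤ ℤ ℓ) (n + 1)) x = 0
  rw [Literature.AlgebraicTopology.SingularHomology.integralBockstein_comp_lsmul]
  rfl

/-- **Prop. 6.7, the shape of the witness (proved).** If an additive integral operation
`θ : H⁴(-; ℤ) → Hᵏ(-; ℤ)` does not vanish on the integral Bockstein `β̃ x ∈ H⁴(BG; ℤ)` of some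
class `x ∈ H³(BG; ℤ/ℓ)` of a finite group `G`, then `θ` detects an `ℓ`-torsion group class
(`DetectsGroupClass ℓ θ`): `y = β̃ x` has `ℓ • y = 0` by `integralBockstein_zsmul_eq_zero`. In
print `G = ℤ_p × ℤ_p × ℤ_p`, `x = u₁u₂u₃ ∈ H³(G; ℤ_p)`, "`y = β(u₁u₂u₃)`".
[cite: AtiyahHirzebruchTopology1962, proof of Prop. 6.7 p. 42] -/
theorem DetectsGroupClass.of_integralBockstein {ℓ : ℕ} [NeZero ℓ]
    {θ : AddCohomologyOperation.{0} ℤ ℤ ℤ (2 * 2) k} (G : Type) [Group G] [Finite G]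
    (x : singularCohomology ℤ (ZMod ℓ) (classifyingSpace G) 3)
    (hx : θ.app (classifyingSpace G)
      (Literature.AlgebraicTopology.SingularHomology.integralBockstein (classifyingSpace G) ℓ 3 x)
        ≠ 0) :
    DetectsGroupClass ℓ θ :=
  -- the instance slots are filled by `inferInstance` (terms), not `‹_›` (postponed tactic blocks,
  -- which would leave the type of `y` with an unassignable instance metavariable)
  ⟨G, inferInstance, inferInstance,
    Literature.AlgebraicTopology.SingularHomology.integralBockstein (classifyingSpace G) ℓ 3 x,
    integralBockstein_zsmul_eq_zero ℓ 3 x, hx⟩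

/-- **Prop. 6.7 reduced to a computation modulo `ℓ` (proved).** For the obstruction operation
`θ = β̃ P ρ` (`bocksteinSandwich hℓ P`; in print `δ𝒫¹`), `DetectsGroupClass ℓ θ` follows from the
existence of a finite group `G` and a class `x ∈ H³(BG; ℤ/ℓ)` with `β (P (β x)) ≠ 0` in
`H^{2ℓ+3}(BG; ℤ/ℓ)`, where `β = ρ ∘ β̃ : Hⁿ(-; ℤ/ℓ) → Hⁿ⁺¹(-; ℤ/ℓ)` is the mod-`ℓ` Bockstein:
take `y = β̃ x`; then `ρ (θ y) = β P β x ≠ 0` forces `θ y ≠ 0`. This is the printed reduction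
(p. 42): "to prove (6.7) we have only to find `y ∈ H²q(G; ℤ_p)` such that `β(y) = 0`,
`Γ(y) ≠ 0`", `Γ = β𝒫¹ - 𝒫¹β` agreeing with `β𝒫¹` on `Ker β ∋ y = β(u₁u₂u₃)`; what remains of
Prop. 6.7 is the computation `β𝒫¹β(u₁u₂u₃) = -Σ(…) ≠ 0` in
`H*((ℤ_p)³; ℤ_p) = Λ(u₁, u₂, u₃) ⊗ ℤ_p[v₁, v₂, v₃]` (Künneth, Cartan formula), not available in
the tree. [cite: AtiyahHirzebruchTopology1962, proof of Prop. 6.7 p. 42] -/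
theorem DetectsGroupClass.of_modBockstein {ℓ : ℕ} (hℓ : ℓ.Prime)
    (P : AddCohomologyOperation.{0} ℤ (ZMod ℓ) (ZMod ℓ) (2 * 2) (2 * ℓ + 2))
    (G : Type) [Group G] [Finite G]
    (x : singularCohomology ℤ (ZMod ℓ) (classifyingSpace G) 3)
    (hx : haveI : NeZero ℓ := ⟨hℓ.ne_zero⟩
      Literature.AlgebraicTopology.SingularHomology.reduceMod (classifyingSpace G) ℓ
          (2 * ℓ + 2 + 1)
        ((bocksteinSandwich hℓ P).app (classifyingSpace G)
          (Literature.AlgebraicTopology.SingularHomology.integralBockstein (classifyingSpace G) ℓ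
            3 x)) ≠ 0) :
    DetectsGroupClass ℓ (bocksteinSandwich hℓ P) := by
  haveI : NeZero ℓ := ⟨hℓ.ne_zero⟩
  refine DetectsGroupClass.of_integralBockstein G x fun h ↦ hx ?_
  rw [h, _root_.map_zero]

/-- Unfolding the hypothesis of `DetectsGroupClass.of_modBockstein`: `ρ (θ (β̃ x))` is literally
the class `β (P (β x))`, `β = ρβ̃` the mod-`ℓ` Bockstein, i.e. `ρ β̃ P ρ β̃ x`
(`bocksteinSandwich_app`). [cite: AtiyahHirzebruchTopology1962, proof of Prop. 6.7 p. 42] -/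
lemma reduceMod_bocksteinSandwich_app_integralBockstein {ℓ : ℕ} (hℓ : ℓ.Prime)
    (P : AddCohomologyOperation.{0} ℤ (ZMod ℓ) (ZMod ℓ) (2 * 2) (2 * ℓ + 2))
    (E : Type) [TopologicalSpace E] (x : singularCohomology ℤ (ZMod ℓ) E 3) :
    haveI : NeZero ℓ := ⟨hℓ.ne_zero⟩
    Literature.AlgebraicTopology.SingularHomology.reduceMod E ℓ (2 * ℓ + 2 + 1)
        ((bocksteinSandwich hℓ P).app E
          (Literature.AlgebraicTopology.SingularHomology.integralBockstein E ℓ 3 x)) =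
      Literature.AlgebraicTopology.SingularHomology.reduceMod E ℓ (2 * ℓ + 2 + 1)
        (Literature.AlgebraicTopology.SingularHomology.integralBockstein E ℓ (2 * ℓ + 2)
          (P.app E (Literature.AlgebraicTopology.SingularHomology.reduceMod E ℓ (2 * 2)
            (Literature.AlgebraicTopology.SingularHomology.integralBockstein E ℓ 3 x)))) :=
  rfl

end HodgeConjecture
end Barriers

end Literature.Barriers.HodgeConjecture

end
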